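import Summits.BirchSwinnertonDyer.BirchSwinnertonDyer.Theorems.EisensteinPrimesKatzLineDescentValues
import Summits.BirchSwinnertonDyer.Rank1Residual.X11b.FramePrincipalUnitPowers
import HarnessLib

/-!
# The key relation of the `λ`-descent (AN-F₂, route (RIG)), expanded to first order, and the
# trichotomy `‖d‖ = 1`, `d^{p^j} → 1` for the period ratio
# (helper file for crux 2 `GoodLatticeBDPValue`, stmt-BirchSwinnertonDyer-19032, line `halves`, stub 3
# `stub_anDS`, piece AN-F₂ `KatzLineDescentAt` of `Cruxes/GoodLatticeBDPValue/Lines/halves_anDS_split_idea11g4.lean`;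
# seat `bsd-line-x1-p1-w3` gen 2)

THE ANALYTIC STEP of the different-period rigidity (RIG). Two CGLS-type frames `Q`, `L` of one
`θ_K` at period pairs `(Ω_K', Ω_p')`, `(Ω_K'', Ω_p'')`, read along the powers `φ₁^k` of one
interpolation character, satisfy `Q(x_k) = d^k · L(x_k)` at `x_k = u^k − 1` (`u = φ̂₁(γ)` a principal
unit of infinite order, `d = c^{2n₁}`, `c = ι⁻¹(Ω_K''/Ω_K')·Ω_p'/Ω_p''`). For bounded `Q, L ∈ ℂ_p⟦T⟧`
(`Q ≠ 0`) and ANY `u, d ∈ ℂ_p` with `‖u − 1‖ < 1`, `u^{p^j} ≠ 1` this file proves: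

* §1 `norm_keyRelation_le`: the first-order expansion of the relation at `x_k` along
  `x_{k+p^j} = x_k + u^k(u^{p^j} − 1)`:
  `‖d^k(d^{p^j} − 1)L(x_k) − h·(Q′(x_k) − d^{k+p^j}L′(x_k))‖ ≤ C‖h‖²(1 + ‖d‖^{k+p^j})`,
  `h = u^k(u^{p^j} − 1)` (toolkit `…KatzLineDescentValues.norm_taylor_sub_le`);
  `exists_tsum_ne_zero`: `Q ≠ 0` has a non-zero value at some `x_k` (identity principle
  `X11b.eq_zero_of_norm_le_of_hasSum_zero_of_tendsto_zero` along `x_{p^j} → 0`).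
* §2 `norm_pow_mul_norm_sub_one_mul_le`, `norm_eq_one_and_tendsto_of_bound`: the norm bookkeeping and
  the trichotomy giving `‖d‖ = 1` and `d^{p^j} → 1`.
* (next file `…KatzLineDescentODE`: `exists_ode_of_relation` — the FORMAL identity
  `(1+T)·(Q·L′ − Q′·L) + a·Q·L = 0` in `ℂ_p⟦T⟧`, solved by `…KatzLineDescentWronskian`.)

Pure `p`-adic analysis; no fact, no definition, no `sorry`; nothing about BSD.
References: Washington 1997 §5.1, §7.1–7.2; Cassels 1986 Ch. 4 Thm. 4.1 (Strassmann); Koblitz 1984 Ch. IV §1.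
-/

-- the summit namespace `Summit.BirchSwinnertonDyer.BirchSwinnertonDyer` repeats the problem name by design (D-0017)
set_option linter.dupNamespace false
set_option autoImplicit false

noncomputable section

open scoped Classical Topology

open Filter Finset PowerSeries
open Summit.BirchSwinnertonDyer.Rank1Residual.X11b

namespace Summit.BirchSwinnertonDyer.BirchSwinnertonDyer.Theorems.KatzLineDescent

variable {p : ℕ} [Fact p.Prime]

/-! ## §1 The first-order expansion of the relation, and a non-zero value of `Q` -/

section Expansion

variable {Q L : PowerSeries ℂ_[p]} {C : ℝ} {u d : ℂ_[p]}

/-- **The key relation, expanded to first order.** If `Q(u^m − 1) = d^m L(u^m − 1)` at `m = k` and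
`m = k + P`, then with `x = u^k − 1`, `h = u^k(u^P − 1)` (so `x + h = u^{k+P} − 1`):
`‖d^k(d^P − 1)·L(x) − h·(Q′(x) − d^{k+P}·L′(x))‖ ≤ C‖h‖²(1 + ‖d‖^{k+P})`.
[cite: Washington1997, §7.1] [cite: Cassels1986, Ch. 4 Thm. 4.1] -/
theorem norm_keyRelation_le (hQ : ∀ n, ‖coeff n Q‖ ≤ C) (hL : ∀ n, ‖coeff n L‖ ≤ C)
    (hu : ‖u - 1‖ < 1) {k P : ℕ}
    (hk : ∑' n, coeff n Q * (u ^ k - 1) ^ n = d ^ k * ∑' n, coeff n L * (u ^ k - 1) ^ n)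
    (hkP : ∑' n, coeff n Q * (u ^ (k + P) - 1) ^ n =
      d ^ (k + P) * ∑' n, coeff n L * (u ^ (k + P) - 1) ^ n) :
    ‖d ^ k * (d ^ P - 1) * (∑' n, coeff n L * (u ^ k - 1) ^ n) -
        u ^ k * (u ^ P - 1) * ((∑' n, coeff (n + 1) Q * (n + 1) * (u ^ k - 1) ^ n) -
          d ^ (k + P) * ∑' n, coeff (n + 1) L * (n + 1) * (u ^ k - 1) ^ n)‖ ≤
      C * ‖u ^ k * (u ^ P - 1)‖ ^ 2 * (1 + ‖d‖ ^ (k + P)) := by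
  have hC : 0 ≤ C := (norm_nonneg _).trans (hQ 0)
  set x := u ^ k - 1 with hx
  set h := u ^ k * (u ^ P - 1) with hh
  have hx1 : ‖x‖ < 1 := (R1.norm_pow_sub_one_le hu k).trans_lt hu
  have hh1 : ‖h‖ < 1 := by
    rw [hh, norm_mul, norm_pow, R1.norm_eq_one_of_norm_sub_one_lt hu, one_pow, one_mul]
    exact (R1.norm_pow_sub_one_le hu P).trans_lt hu
  have hxh : x + h = u ^ (k + P) - 1 := by rw [hx, hh, pow_add]; ring
  rw [← hxh] at hkP
  have tQ := norm_taylor_sub_le hQ hx1 hh1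
  have tL := norm_taylor_sub_le hL hx1 hh1
  -- abbreviations for the six values
  set f0 := ∑' n, coeff n Q * x ^ n
  set f1 := ∑' n, coeff n Q * (x + h) ^ n
  set f' := ∑' n, coeff (n + 1) Q * (n + 1) * x ^ n
  set g0 := ∑' n, coeff n L * x ^ n
  set g1 := ∑' n, coeff n L * (x + h) ^ n
  set g' := ∑' n, coeff (n + 1) L * (n + 1) * x ^ n
  have key : d ^ k * (d ^ P - 1) * g0 - h * (f' - d ^ (k + P) * g') =
      (f1 - f0 - h * f') + -(d ^ (k + P) * (g1 - g0 - h * g')) := by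
    rw [pow_add] at hkP ⊢
    linear_combination hk - hkP
  rw [key]
  refine (IsUltrametricDist.norm_add_le_max _ _).trans (max_le ?_ ?_)
  · refine tQ.trans ?_
    have : 0 ≤ C * ‖h‖ ^ 2 * ‖d‖ ^ (k + P) := by positivity
    nlinarith
  · rw [norm_neg, norm_mul, norm_pow]
    calc ‖d‖ ^ (k + P) * ‖g1 - g0 - h * g'‖ ≤ ‖d‖ ^ (k + P) * (C * ‖h‖ ^ 2) :=
          mul_le_mul_of_nonneg_left tL (pow_nonneg (norm_nonneg _) _)
      _ ≤ C * ‖h‖ ^ 2 * (1 + ‖d‖ ^ (k + P)) := by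
          have : 0 ≤ C * ‖h‖ ^ 2 := by positivity
          nlinarith

/-- **A non-zero bounded series has a non-zero value at some `u^k − 1`, `k ≥ 1`** (`u` a principal
unit with `u^{p^j} ≠ 1`): otherwise it vanishes along `u^{p^j} − 1 → 0` and the identity principle
gives `Q = 0`. [cite: Cassels1986, Ch. 4 Thm. 4.1] -/
theorem exists_tsum_ne_zero (hQ : ∀ n, ‖coeff n Q‖ ≤ C) (hQ0 : Q ≠ 0) (hu : ‖u - 1‖ < 1)
    (hu' : ∀ j : ℕ, u ^ p ^ j ≠ 1) :
    ∃ k : ℕ, 1 ≤ k ∧ ∑' n, coeff n Q * (u ^ k - 1) ^ n ≠ 0 := by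
  by_contra H
  push Not at H
  apply hQ0
  have hε : Tendsto (fun j : ℕ ↦ u ^ p ^ j - 1) atTop (𝓝 0) := by
    have h := (tendsto_pow_prime_pow_padicComplex hu).sub_const 1
    rwa [sub_self] at h
  have hε0 : ∃ᶠ j in atTop, u ^ p ^ j - 1 ≠ 0 :=
    Frequently.of_forall fun j ↦ sub_ne_zero.mpr (hu' j)
  have hval : ∀ j, HasSum (fun n ↦ coeff n Q * (u ^ p ^ j - 1) ^ n) 0 := by
    intro j
    have h1 := H (p ^ j) (Nat.one_le_pow _ _ (Fact.out : p.Prime).pos)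
    rw [← h1]
    exact hasSum_coeff hQ ((R1.norm_pow_sub_one_le hu _).trans_lt hu)
  have hc := eq_zero_of_norm_le_of_hasSum_zero_of_tendsto_zero hQ hε hε0 hval
  ext n
  simpa using congrFun hc n

end Expansion

/-! ## §2 `‖d‖ = 1` and `d^{p^j} → 1` -/

section Trichotomy

/-- Norm bookkeeping for the key relation: from
`‖d^k(d^P − 1)g₀ − vε·(f₁ − d^{k+P}g₁)‖ ≤ C‖vε‖²(1 + ‖d‖^{k+P})` with `‖v‖ = 1`, `‖ε‖ ≤ 1`,
`‖f₁‖, ‖g₁‖ ≤ C` one gets `‖d‖^k·‖d^P − 1‖·‖g₀‖ ≤ 2C‖ε‖·max(1, ‖d‖^{k+P})`. [folklore] -/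
theorem norm_pow_mul_norm_sub_one_mul_le {g₀ f₁ g₁ v ε d : ℂ_[p]} {k P : ℕ} {C : ℝ}
    (hv : ‖v‖ = 1) (hε : ‖ε‖ ≤ 1) (hf₁ : ‖f₁‖ ≤ C) (hg₁ : ‖g₁‖ ≤ C)
    (h : ‖d ^ k * (d ^ P - 1) * g₀ - v * ε * (f₁ - d ^ (k + P) * g₁)‖ ≤
      C * ‖v * ε‖ ^ 2 * (1 + ‖d‖ ^ (k + P))) :
    ‖d‖ ^ k * ‖d ^ P - 1‖ * ‖g₀‖ ≤ 2 * C * ‖ε‖ * max 1 (‖d‖ ^ (k + P)) := by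
  have hC : 0 ≤ C := (norm_nonneg _).trans hf₁
  set M := max 1 (‖d‖ ^ (k + P)) with hM
  have hM1 : 1 ≤ M := le_max_left _ _
  have hM2 : ‖d‖ ^ (k + P) ≤ M := le_max_right _ _
  have hvε : ‖v * ε‖ = ‖ε‖ := by rw [norm_mul, hv, one_mul]
  rw [hvε] at h
  set A := d ^ k * (d ^ P - 1) * g₀ with hA
  set B := v * ε * (f₁ - d ^ (k + P) * g₁) with hB
  have hBle : ‖B‖ ≤ ‖ε‖ * (C * M) := by
    rw [hB, norm_mul, hvε]
    refine mul_le_mul_of_nonneg_left ?_ (norm_nonneg _)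
    calc ‖f₁ - d ^ (k + P) * g₁‖ = ‖f₁ + -(d ^ (k + P) * g₁)‖ := by rw [sub_eq_add_neg]
      _ ≤ max ‖f₁‖ ‖-(d ^ (k + P) * g₁)‖ := IsUltrametricDist.norm_add_le_max _ _
      _ ≤ C * M := by
          rw [norm_neg, norm_mul, norm_pow]
          refine max_le ?_ ?_
          · calc ‖f₁‖ ≤ C := hf₁
              _ = C * 1 := (mul_one C).symm
              _ ≤ C * M := mul_le_mul_of_nonneg_left hM1 hC
          · calc ‖d‖ ^ (k + P) * ‖g₁‖ ≤ M * C := mul_le_mul hM2 hg₁ (norm_nonneg _) (zero_le_one.trans hM1)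
              _ = C * M := mul_comm _ _
  have hAB : ‖A - B‖ ≤ 2 * C * ‖ε‖ * M := by
    refine h.trans ?_
    have h1 : 1 + ‖d‖ ^ (k + P) ≤ 2 * M := by linarith
    have h2 : ‖ε‖ ^ 2 ≤ ‖ε‖ := by
      rw [sq]; exact mul_le_of_le_one_left (norm_nonneg _) hε
    calc C * ‖ε‖ ^ 2 * (1 + ‖d‖ ^ (k + P)) ≤ C * ‖ε‖ * (2 * M) := by gcongr
      _ = 2 * C * ‖ε‖ * M := by ring
  have hAeq : ‖A‖ = ‖d‖ ^ k * ‖d ^ P - 1‖ * ‖g₀‖ := by rw [hA, norm_mul, norm_mul, norm_pow]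
  rw [← hAeq]
  calc ‖A‖ = ‖(A - B) + B‖ := by rw [sub_add_cancel]
    _ ≤ max ‖A - B‖ ‖B‖ := IsUltrametricDist.norm_add_le_max _ _
    _ ≤ 2 * C * ‖ε‖ * M := max_le hAB (hBle.trans (by nlinarith [norm_nonneg ε, mul_nonneg hC (zero_le_one.trans hM1)]))

/-- **Trichotomy**: if `‖d‖^k·‖d^{p^j} − 1‖·‖g₀‖ ≤ 2C‖ε_j‖·max(1, ‖d‖^{k+p^j})` for all `j` with
`ε_j → 0`, `g₀ ≠ 0`, `d ≠ 0`, then `‖d‖ = 1` and `d^{p^j} → 1`. (`‖d‖ > 1`: the maximum is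
`‖d‖^{k+p^j}` and `‖d^{p^j} − 1‖ = ‖d‖^{p^j}`, leaving `‖g₀‖ ≤ 2C‖ε_j‖ → 0`; `‖d‖ < 1`:
`‖d^{p^j} − 1‖ = 1`, leaving `‖d‖^k‖g₀‖ ≤ 2C‖ε_j‖ → 0`.) [cite: Washington1997, §5.1]
[cite: Cassels1986, Ch. 4 Thm. 4.1] -/
theorem norm_eq_one_and_tendsto_of_bound {g₀ d : ℂ_[p]} {k : ℕ} {C : ℝ} {ε : ℕ → ℂ_[p]}
    (hg₀ : g₀ ≠ 0) (hd : d ≠ 0) (hε : Tendsto ε atTop (𝓝 0))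
    (h : ∀ j : ℕ, ‖d‖ ^ k * ‖d ^ p ^ j - 1‖ * ‖g₀‖ ≤
      2 * C * ‖ε j‖ * max 1 (‖d‖ ^ (k + p ^ j))) :
    ‖d‖ = 1 ∧ Tendsto (fun j : ℕ ↦ d ^ p ^ j) atTop (𝓝 1) := by
  have hεn : Tendsto (fun j ↦ 2 * C * ‖ε j‖) atTop (𝓝 0) := by
    have := (tendsto_norm_zero.comp hε).const_mul (2 * C)
    simpa using this
  have hP : ∀ j : ℕ, 1 ≤ p ^ j := fun j ↦ Nat.one_le_pow _ _ (Fact.out : p.Prime).pos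
  have hg₀n : 0 < ‖g₀‖ := norm_pos_iff.mpr hg₀
  have hdn : 0 < ‖d‖ := norm_pos_iff.mpr hd
  -- `‖d‖ = 1`
  have hd1 : ‖d‖ = 1 := by
    rcases lt_trichotomy ‖d‖ 1 with hlt | heq | hgt
    · -- `‖d‖ < 1`: `‖d^P − 1‖ = 1`, `max = 1`
      exfalso
      have hb : ∀ j, ‖d‖ ^ k * ‖g₀‖ ≤ 2 * C * ‖ε j‖ := by
        intro j
        have hdP : ‖d ^ p ^ j‖ < 1 := by
          rw [norm_pow]; exact pow_lt_one₀ (norm_nonneg _) hlt (Nat.pos_iff_ne_zero.mp (hP j))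
        have h1 : ‖d ^ p ^ j - 1‖ = 1 := by
          rw [sub_eq_add_neg, IsUltrametricDist.norm_add_eq_max_of_norm_ne_norm, norm_neg, norm_one]
          · exact max_eq_right hdP.le
          · rw [norm_neg, norm_one]; exact hdP.ne
        have h2 : max 1 (‖d‖ ^ (k + p ^ j)) = 1 :=
          max_eq_left (pow_le_one₀ (norm_nonneg _) hlt.le)
        have := h j
        rw [h1, h2, mul_one, mul_one] at this
        exact this
      have hlim : ‖d‖ ^ k * ‖g₀‖ ≤ 0 :=
        ge_of_tendsto' hεn fun j ↦ hb j
      have : 0 < ‖d‖ ^ k * ‖g₀‖ := mul_pos (pow_pos hdn _) hg₀n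
      linarith
    · exact heq
    · -- `‖d‖ > 1`: `‖d^P − 1‖ = ‖d‖^P`, `max = ‖d‖^{k+P}`
      exfalso
      have hb : ∀ j, ‖g₀‖ ≤ 2 * C * ‖ε j‖ := by
        intro j
        have hdP : 1 < ‖d ^ p ^ j‖ := by
          rw [norm_pow]; exact one_lt_pow₀ hgt (Nat.pos_iff_ne_zero.mp (hP j))
        have h1 : ‖d ^ p ^ j - 1‖ = ‖d‖ ^ p ^ j := by
          rw [sub_eq_add_neg, IsUltrametricDist.norm_add_eq_max_of_norm_ne_norm, norm_neg, norm_one,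
            norm_pow]
          · exact max_eq_left (by rw [← norm_pow]; exact hdP.le)
          · rw [norm_neg, norm_one]; exact hdP.ne'
        have h2 : max 1 (‖d‖ ^ (k + p ^ j)) = ‖d‖ ^ (k + p ^ j) :=
          max_eq_right (one_le_pow₀ hgt.le)
        have := h j
        rw [h1, h2, ← pow_add, mul_comm (‖d‖ ^ (k + p ^ j)) ‖g₀‖] at this
        exact le_of_mul_le_mul_right this (pow_pos hdn _)
      have hlim : ‖g₀‖ ≤ 0 := ge_of_tendsto' hεn fun j ↦ hb j
      linarith
  refine ⟨hd1, ?_⟩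
  -- `d^{p^j} → 1`
  have hb : ∀ j, ‖d ^ p ^ j - 1‖ ≤ 2 * C * ‖ε j‖ / ‖g₀‖ := by
    intro j
    have := h j
    rw [hd1, one_pow, one_pow, max_self, one_mul, mul_one] at this
    rwa [le_div_iff₀ hg₀n]
  have hlim : Tendsto (fun j ↦ 2 * C * ‖ε j‖ / ‖g₀‖) atTop (𝓝 0) := by
    simpa using hεn.div_const ‖g₀‖
  rw [tendsto_iff_norm_sub_tendsto_zero]
  exact squeeze_zero (fun _ ↦ norm_nonneg _) hb hlim

end Trichotomy

end Summit.BirchSwinnertonDyer.BirchSwinnertonDyer.Theorems.KatzLineDescent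

end
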